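import Literature.AlgebraicGeometry.Frobenioids.AngularFrobenioids
import Literature.AlgebraicGeometry.Frobenioids.ArchimedeanRegionCalculus
import Literature.AlgebraicGeometry.Frobenioids.ArchimedeanHalfCircleArcs
import HarnessLib

/-!
# Frobenioids II, Proposition 3.4 (iii): the half-circle witness at the level of `C₀`
# (abc-iut cell, layer L1, node `FrdII:Prop3.4(iii)`, chain LC-L1-2 — part 1 of the refutation)

Mochizuki, *The geometry of Frobenioids II: poly-Frobenioids*, Kyushu J. Math. **62** (2008)
401–460, §3, Proposition 3.4 (iii) p. 30 ("FSM-morphisms of `F` project to FSM-morphisms of `D`"),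
proof p. 31 ll. 6–9. [cite: MochizukiFrdII2008, Prop 3.4 (iii) p.30]

PROOF-ONLY file (nothing defined): the `C₀`-level facts behind the counterexample of
`ArchimedeanFSMCounterexample.lean` (seat abc-iut-L1-d3). The witness object is
`X = (Spec ℂ, A_X)` with angular part the open right half-circle `B = {Re > 0} = arcDir 1 (π/2)` and
tip `1`; the witness arrow is the linear isometry `φ₀ = (Spec ℂ → Spec ℝ, 1, i) : X → (Spec ℝ, [0,1])`.
* `C0.no_conj_pair_of_re_pos` — two linear arrows `a, b : V → X` with `φ₀ ∘ a = φ₀ ∘ b` cannot have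
  different base twists: the scalar identity `τ_a(i) c_a = τ_b(i) c_b` would give `c_b = −c_a`, while
  both `c_a · A_V` and `c_b · A_V` lie in a twist of `A_X`, i.e. in `{Re > 0}` (monomorphism half);
* `C0.exists_factor_real`, `C0.exists_lift_pair` — the factorizations / joint lifts of test arrows
  `γ₀ : W → (Spec ℝ, [0,1])` through `φ₀` for `W` real, resp. complex, the complex case with a twist
  `τ ∈ {id, conj}` prescribed by a sign (fiberwise-surjectivity half);
(The elementary arc / twist lemmas live in `ArchimedeanHalfCircleArcs.lean`.)
No side is taken on [IUTchIII] Cor. 3.12.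
-/

namespace Literature.AlgebraicGeometry.Frobenioids

open CategoryTheory Set
open scoped Pointwise

noncomputable section

namespace ArchFrd

/-! ### Angular regions are nonempty -/

/-- Every angular region of `ℂ^×` has a point. [cite: MochizukiFrdII2008, Def 3.1 (iii) p.24] -/
theorem AngularRegion.carrier_nonempty (A : AngularRegion ℂ) : A.carrier.Nonempty := by
  obtain ⟨z, hz, -⟩ := (A.isConnected_inter 1).nonempty
  obtain ⟨h1, h2⟩ := unitPart_absHom_polar (K := ℂ) z A.tip
  refine ⟨(z : ℂˣ) * ofPosReal ℂ A.tip, ?_, ?_⟩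
  · show unitPart ℂ _ ∈ A.dir
    rw [h1]
    exact hz
  · show absHom ℂ _ ≤ A.tip
    rw [h2]

namespace C0

/-- **The monomorphism half of the counterexample** (`C₀` level): for `X` with angular part the
right half-circle and `φ₀ : X → Y` linear with scalar `i`, two arrows `a, b : V → X` (of any, then
necessarily equal, Frobenius degree) with `φ₀ ∘ a = φ₀ ∘ b` cannot have different base twists
(their scalars would be opposite, while both images lie in `{Re > 0}`). [cite: MochizukiFrdII2008, Prop 3.4 (iii) p.30] -/
theorem no_conj_pair_of_re_pos {X V Y : C0} (hX : X.region.dir = arcDir 1 (Real.pi / 2))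
    (φ : X ⟶ Y) (hφs : ((scalar φ : ℂˣ) : ℂ) = Complex.I) (hφd : degFr φ = 1)
    (a b : V ⟶ X) (hab : a ≫ φ = b ≫ φ)
    (hne : D0.Hom.twists (Base a) ≠ D0.Hom.twists (Base b)) : False := by
  -- the two arrows have the same Frobenius degree
  have hdeg : degFr a = degFr b := by
    have := congrArg degFr hab
    rwa [degFr_comp', degFr_comp', hφd, mul_one, mul_one] at this
  obtain ⟨u, hu⟩ := (V.region.carrier_nonempty).pow (n := (degFr a : ℕ))
  -- both scalars move `u` into the right half-plane
  have hpos : ∀ (e : V ⟶ X), degFr e = degFr a → 0 < ((scalar e : ℂ) * (u : ℂ)).re := by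
    intro e he
    have hm := e.mapsTo
    rw [show Hom.degFr e = degFr a from he] at hm
    have := re_pos_of_mem_pullRegion hX (Base e) (hm (smul_mem_smul_set hu))
    rwa [smul_eq_mul, Units.val_mul] at this
  have hpa := hpos a rfl
  have hpb := hpos b hdeg.symm
  -- the scalar equation
  have hsc := congrArg (fun f => ((scalar f : ℂˣ) : ℂ)) hab
  simp only [scalar_comp', hφd, PNat.one_coe, pow_one, Units.val_mul] at hsc
  change ((D0.galAct (D0.Hom.twists (Base a)) (scalar φ) : ℂˣ) : ℂ) * _ =
    ((D0.galAct (D0.Hom.twists (Base b)) (scalar φ) : ℂˣ) : ℂ) * _ at hsc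
  have hval : ∀ σ : Bool, ((D0.galAct σ (scalar φ) : ℂˣ) : ℂ) =
      if σ then -Complex.I else Complex.I := by
    intro σ
    cases σ
    · rw [D0.galAct_false, hφs]; rfl
    · rw [D0.galAct_true, Units.coe_star, ← starRingEnd_apply, hφs, Complex.conj_I]; rfl
  rw [hval, hval] at hsc
  have key : ((scalar b : ℂˣ) : ℂ) = -((scalar a : ℂˣ) : ℂ) := by
    rcases Bool.eq_false_or_eq_true (D0.Hom.twists (Base a)) with hta | hta <;>
      rcases Bool.eq_false_or_eq_true (D0.Hom.twists (Base b)) with htb | htb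
    · exact (hne (hta.trans htb.symm)).elim
    · -- a twisted, b untwisted: -I * ca = I * cb
      rw [hta, htb, if_pos rfl, if_neg Bool.false_ne_true] at hsc
      have h3 : Complex.I * (scalar b : ℂ) = Complex.I * (-(scalar a : ℂ)) := by
        rw [mul_neg, ← neg_mul]
        exact hsc.symm
      exact mul_left_cancel₀ Complex.I_ne_zero h3
    · -- a untwisted, b twisted: I * ca = -I * cb
      rw [hta, htb, if_neg Bool.false_ne_true, if_pos rfl] at hsc
      have h3 : Complex.I * (scalar b : ℂ) = Complex.I * (-(scalar a : ℂ)) := by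
        rw [mul_neg, hsc, neg_mul, neg_neg]
      exact mul_left_cancel₀ Complex.I_ne_zero h3
    · exact (hne (hta.trans htb.symm)).elim
  rw [key, neg_mul, Complex.neg_re] at hpb
  linarith

/-- **Fiberwise-surjectivity, real test objects** (`C₀` level): for `W` real and a linear isometry
`γ₀ : W → (Spec ℝ, [0,1])`, the arrow `δ₂ = (Spec ℂ → Spec ℝ, 1, i / c_γ) : X → W` satisfies
`γ₀ ∘ δ₂ = φ₀`. [cite: MochizukiFrdII2008, Prop 3.4 (iii) p.30] -/
theorem exists_factor_real {RW : AngularRegion ℂ} (hRW : D0.real = D0.real → RW.IsIsotropic)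
    (γ : C0.mk D0.real RW hRW ⟶ realOfTip 1) (hγd : degFr γ = 1)
    (hγI : PreFrobenioid.IsIsometry toElem γ)
    {RX : AngularRegion ℂ} (hRX : D0.complex = D0.real → RX.IsIsotropic) (hRXt : RX.tip = 1)
    (φ : C0.mk D0.complex RX hRX ⟶ realOfTip 1) (hφd : degFr φ = 1)
    (hφs : scalar φ = Units.mk0 Complex.I Complex.I_ne_zero) :
    ∃ δ : C0.mk D0.complex RX hRX ⟶ C0.mk D0.real RW hRW,
      degFr δ = 1 ∧ PreFrobenioid.IsIsometry toElem δ ∧ δ ≫ γ = φ := by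
  have hγt : ‖((scalar γ : ℂˣ) : ℂ)‖ * (RW.tip : ℝ) = 1 := by
    have := (A0.isIsometry_iff_norm_mul_tip_pow γ).mp hγI
    rw [hγd, PNat.one_coe, pow_one] at this
    exact this
  have hcpos : 0 < ‖((scalar γ : ℂˣ) : ℂ)‖ := norm_pos_iff.mpr (scalar γ).ne_zero
  have hγt' : (RW.tip : ℝ) = ‖((scalar γ : ℂˣ) : ℂ)‖⁻¹ := eq_inv_of_mul_eq_one_right hγt
  have hmaps : (Units.mk0 Complex.I Complex.I_ne_zero * (scalar γ)⁻¹) •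
      (C0.mk D0.complex RX hRX).region.carrier ^ ((1 : ℕ+) : ℕ) ⊆
      pullRegion (C0.mk D0.real RW hRW) D0.toRealHom := by
    rw [PNat.one_coe, pow_one]
    rintro _ ⟨x, hx, rfl⟩
    show (Units.mk0 Complex.I Complex.I_ne_zero * (scalar γ)⁻¹) • x ∈ D0.toRealHom.act '' RW.carrier
    unfold D0.Hom.act
    rw [D0.twists_toRealHom, D0.image_galAct_false, mem_carrier_of_isIsotropic (hRW rfl),
      absHom_le_iff, smul_eq_mul, Units.val_mul, Units.val_mul, norm_mul, norm_mul,
      Units.val_inv_eq_inv_val, norm_inv, hγt', Units.val_mk0, Complex.norm_I, one_mul]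
    have hx1 : ‖(x : ℂ)‖ ≤ 1 := by
      have := (absHom_le_iff x RX.tip).mp hx.2
      rwa [hRXt] at this
    calc ‖((scalar γ : ℂˣ) : ℂ)‖⁻¹ * ‖(x : ℂ)‖ ≤ ‖((scalar γ : ℂˣ) : ℂ)‖⁻¹ * 1 :=
          mul_le_mul_of_nonneg_left hx1 (inv_nonneg.mpr (norm_nonneg _))
      _ = _ := mul_one _
  have hmem : Units.mk0 Complex.I Complex.I_ne_zero * (scalar γ)⁻¹ ∈
      D0.scalars (C0.mk D0.complex RX hRX).base := by
    show _ ∈ D0.scalars D0.complex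
    rw [D0.scalars_complex]
    exact Subgroup.mem_top _
  refine ⟨⟨D0.toRealHom, 1, _, hmem, hmaps⟩, rfl, ?_, ?_⟩
  · rw [A0.isIsometry_iff_norm_mul_tip_pow]
    show ‖((Units.mk0 Complex.I Complex.I_ne_zero * (scalar γ)⁻¹ : ℂˣ) : ℂ)‖ * (RX.tip : ℝ) ^
      ((1 : ℕ+) : ℕ) = (RW.tip : ℝ)
    rw [PNat.one_coe, pow_one, hRXt, Units.val_mul, norm_mul, Units.val_mk0, Complex.norm_I, one_mul,
      Units.val_inv_eq_inv_val, norm_inv, hγt', Positive.val_one, mul_one]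
  · refine C0.hom_ext (D0.hom_to_real_eq rfl _ _) ?_ ?_
    · rw [degFr_comp', hγd, hφd]
      exact (mul_one _).trans rfl
    · rw [scalar_comp', hγd, PNat.one_coe, pow_one, hφs]
      show D0.galAct (D0.Hom.twists D0.toRealHom) (scalar γ) * _ = _
      rw [D0.twists_toRealHom, D0.galAct_false, mul_comm, mul_assoc, inv_mul_cancel, mul_one]

/-- **Fiberwise-surjectivity, complex test objects** (`C₀` level): for `W` complex with a point `z₁`
of its angular part such that `τ(i)⁻¹ c_γ z₁` has positive real part (`τ` the twist `σ`), the arc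
object `V` around `1` (small, tip of `W`) carries linear isometries `δ₁ = (τ, 1, τ(i)⁻¹ c_γ z₁) : V → X`
and `δ₂ = (id, 1, z₁) : V → W` with `φ₀ ∘ δ₁ = γ₀ ∘ δ₂`. [cite: MochizukiFrdII2008, Prop 3.4 (iii) p.30] -/
theorem exists_lift_pair {RW : AngularRegion ℂ} (hRW : D0.complex = D0.real → RW.IsIsotropic)
    (γ : C0.mk D0.complex RW hRW ⟶ realOfTip 1) (hγd : degFr γ = 1)
    (hγI : PreFrobenioid.IsIsometry toElem γ)
    {RX : AngularRegion ℂ} (hRX : D0.complex = D0.real → RX.IsIsotropic)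
    (hRXd : RX.dir = arcDir 1 (Real.pi / 2)) (hRXt : RX.tip = 1)
    (φ : C0.mk D0.complex RX hRX ⟶ realOfTip 1) (hφd : degFr φ = 1)
    (hφs : scalar φ = Units.mk0 Complex.I Complex.I_ne_zero)
    (σ : Bool) {z₁ : ↥(normOneSubgroup ℂ)} (hz₁ : z₁ ∈ RW.dir)
    (hre : 0 < ((((D0.galAct σ (Units.mk0 Complex.I Complex.I_ne_zero))⁻¹ * scalar γ * (z₁ : ℂˣ) :
      ℂˣ) : ℂ)).re) :
    ∃ (RV : AngularRegion ℂ) (hRV : D0.complex = D0.real → RV.IsIsotropic)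
      (δ₁ : C0.mk D0.complex RV hRV ⟶ C0.mk D0.complex RX hRX)
      (δ₂ : C0.mk D0.complex RV hRV ⟶ C0.mk D0.complex RW hRW),
      Base δ₁ = D0.Hom.gal σ ∧ Base δ₂ = 𝟙 D0.complex ∧ degFr δ₁ = 1 ∧ degFr δ₂ = 1 ∧
        PreFrobenioid.IsIsometry toElem δ₁ ∧ PreFrobenioid.IsIsometry toElem δ₂ ∧
        δ₁ ≫ φ = δ₂ ≫ γ := by
  set Iu : ℂˣ := Units.mk0 Complex.I Complex.I_ne_zero with hIu
  set c₁ : ℂˣ := (D0.galAct σ Iu)⁻¹ * scalar γ * (z₁ : ℂˣ) with hc₁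
  have hγt : ‖((scalar γ : ℂˣ) : ℂ)‖ * (RW.tip : ℝ) = 1 := by
    have := (A0.isIsometry_iff_norm_mul_tip_pow γ).mp hγI
    rw [hγd, PNat.one_coe, pow_one] at this
    exact this
  have hz₁n : ‖(((z₁ : ℂˣ)) : ℂ)‖ = 1 := (mem_normOneSubgroup_iff ℂ _).1 z₁.2
  have hIun : ‖((D0.galAct σ Iu : ℂˣ) : ℂ)‖ = 1 := by
    rw [D0.norm_galAct, hIu, Units.val_mk0, Complex.norm_I]
  have hc₁n : ‖(c₁ : ℂ)‖ = ‖((scalar γ : ℂˣ) : ℂ)‖ := by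
    rw [hc₁, Units.val_mul, Units.val_mul, norm_mul, norm_mul, Units.val_inv_eq_inv_val, norm_inv,
      hIun, hz₁n, inv_one, one_mul, mul_one]
  -- the unit part `p` of `c₁` lies in the right half-circle; choose the arc width
  have hp : unitPart ℂ c₁ ∈ arcDir 1 (Real.pi / 2) := by
    rw [mem_arcDir_one_iff, re_unitPart_pos_iff]
    exact hre
  obtain ⟨ε₁, hε₁, hε₁π, harc₁⟩ :=
    exists_arcDir_subset (isOpen_arcDir 1 (by linarith [Real.pi_pos])) hp
  obtain ⟨ε₂, hε₂, hε₂π, harc₂⟩ := exists_arcDir_subset RW.isOpen_dir hz₁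
  have hε : 0 < min ε₁ ε₂ := lt_min hε₁ hε₂
  have hεπ : min ε₁ ε₂ < Real.pi := lt_of_le_of_lt (min_le_left _ _) hε₁π
  let RV : AngularRegion ℂ := arcRegion 1 (min ε₁ ε₂) hε hεπ RW.tip
  have hRV : D0.complex = D0.real → RV.IsIsotropic := fun h => nomatch h
  -- condition (c) for δ₂ = (id, 1, z₁)
  have hm₂ : (z₁ : ℂˣ) • (C0.mk D0.complex RV hRV).region.carrier ^ ((1 : ℕ+) : ℕ) ⊆
      pullRegion (C0.mk D0.complex RW hRW) (𝟙 D0.complex) := by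
    rw [PNat.one_coe, pullRegion_id]
    refine (RV.smul_carrier_pow_subset_iff RW (z₁ : ℂˣ) 0).mpr ⟨?_, ?_⟩
    · rw [zero_add, pow_one, unitPart_normOne_coe]
      rintro _ ⟨y, hy, rfl⟩
      apply harc₂
      apply arcDir_subset_arcDir z₁ (min_le_right ε₁ ε₂)
      have : z₁ * y ∈ arcDir (z₁ * 1) (min ε₁ ε₂) := (mem_arcDir_mul_iff z₁ 1 y _).mpr hy
      rwa [mul_one] at this
    · rw [zero_add, pow_one, absHom_coe_normOne, one_mul]
      exact le_rfl
  -- condition (c) for δ₁ = (gal σ, 1, c₁)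
  have hm₁ : c₁ • (C0.mk D0.complex RV hRV).region.carrier ^ ((1 : ℕ+) : ℕ) ⊆
      pullRegion (C0.mk D0.complex RX hRX) (D0.Hom.gal σ) := by
    rw [PNat.one_coe, pow_one]
    rintro _ ⟨y, hy, rfl⟩
    refine ⟨D0.galAct σ (c₁ * y), ⟨?_, ?_⟩, ?_⟩
    · show unitPart ℂ (D0.galAct σ (c₁ * y)) ∈ RX.dir
      rw [hRXd, mem_arcDir_one_iff, re_unitPart_pos_iff, re_galAct, ← re_unitPart_pos_iff,
        ← mem_arcDir_one_iff, unitPart_mul]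
      apply harc₁
      apply arcDir_subset_arcDir _ (min_le_left ε₁ ε₂)
      have : unitPart ℂ c₁ * unitPart ℂ y ∈ arcDir (unitPart ℂ c₁ * 1) (min ε₁ ε₂) :=
        (mem_arcDir_mul_iff _ 1 _ _).mpr hy.1
      rwa [mul_one] at this
    · show absHom ℂ (D0.galAct σ (c₁ * y)) ≤ RX.tip
      rw [absHom_galAct, absHom_le_iff, Units.val_mul, norm_mul, hc₁n, hRXt, Positive.val_one, ← hγt]
      exact mul_le_mul_of_nonneg_left ((absHom_le_iff y RW.tip).mp hy.2) (norm_nonneg _)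
    · show D0.galAct (D0.Hom.twists (D0.Hom.gal σ)) _ = _
      rw [D0.twists_gal, D0.galAct_galAct]
      rfl
  have hmemX : c₁ ∈ D0.scalars (C0.mk D0.complex RV hRV).base := by
    show _ ∈ D0.scalars D0.complex
    rw [D0.scalars_complex]
    exact Subgroup.mem_top _
  have hmemW : (z₁ : ℂˣ) ∈ D0.scalars (C0.mk D0.complex RV hRV).base := by
    show _ ∈ D0.scalars D0.complex
    rw [D0.scalars_complex]
    exact Subgroup.mem_top _
  refine ⟨RV, hRV, ⟨D0.Hom.gal σ, 1, c₁, hmemX, hm₁⟩, ⟨𝟙 D0.complex, 1, (z₁ : ℂˣ), hmemW, hm₂⟩,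
    rfl, rfl, rfl, rfl, ?_, ?_, ?_⟩
  · rw [A0.isIsometry_iff_norm_mul_tip_pow]
    show ‖(c₁ : ℂ)‖ * (RW.tip : ℝ) ^ ((1 : ℕ+) : ℕ) = (RX.tip : ℝ)
    rw [PNat.one_coe, pow_one, hc₁n, hγt, hRXt, Positive.val_one]
  · rw [A0.isIsometry_iff_norm_mul_tip_pow]
    show ‖((z₁ : ℂˣ) : ℂ)‖ * (RW.tip : ℝ) ^ ((1 : ℕ+) : ℕ) = (RW.tip : ℝ)
    rw [PNat.one_coe, pow_one, hz₁n, one_mul]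
  · refine C0.hom_ext (D0.hom_to_real_eq rfl _ _) ?_ ?_
    · rw [degFr_comp', degFr_comp', hγd, hφd]
    · rw [scalar_comp', scalar_comp', hγd, hφd, PNat.one_coe, pow_one, pow_one, hφs]
      show D0.galAct (D0.Hom.twists (D0.Hom.gal σ)) Iu * c₁ =
        D0.galAct (D0.Hom.twists (𝟙 D0.complex)) (scalar γ) * (z₁ : ℂˣ)
      rw [D0.twists_gal, D0.twists_id, D0.galAct_false, hc₁, ← mul_assoc, ← mul_assoc,
        mul_inv_cancel, one_mul]

end C0

end ArchFrd

end

end Literature.AlgebraicGeometry.Frobenioids
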